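import Mathlib
import HarnessLib
import HarnessLib.Audit
import Summits.Parity.Statement
import Literature.NumberTheory.Sieve.SingularSeries
import Summits.Parity.GeneralizedHardyLittlewood.Theorems.LiouvilleShiftedTablesBVLiouville
import Literature.NumberTheory.Sieve.LevelOfDistribution

/-!
Route: LiouvilleMAD

DORMANT since 2026-09-03T09:42:47Z (reconciler: no traction for 5 d (last activity statement-checked at 2026-08-29T08:50:19Z); parked, not closed — `ledger route dormant route-Parity-LiouvilleMAD --off` to reactivate) — unstaffed, not closed; items shared with open routes are served there. `ledger route dormant <id> --off` reactivates.

# Route LiouvilleMAD — Liouville δ-method — coset/fan decorrelation (MAD) ⇒ power-saving Type II for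
λ(mn+c) ⇒ BV at level x^ε for Λ(n)λ(n+h) ⇒ (with EH) Hardy–Littlewood pairs; GHL via the
complementary sector pairs → GHL, carried in the crux EngineToGHL

Conforming re-filing (D-0027 §2.1) of card minor-arc-decorrelation, whose first route
MinorArcDecorrelation was retired
`not-a-thesis` because its assembly stopped at the atom Σ_d μ(d)Λ(dm+h) = o(x); its decorrelation,
divisor-switch and
Type-II items are re-filed verbatim (the originals stmt-Parity-8050…8057 are moot), its
fixed-modulus tail (VaughanReduction,
LiouvilleToMobius, atom 0612) is replaced by the level-x^ε node LambdaLiouvilleLevel, and the chain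
is extended to the sub-problem
Statement. It suffices to show X = MAD ∧ ElliottHalberstam ∧ EngineToGHL, where MAD :=
CosetDecorrelation ∧ FanDecorrelation is the
card's minor-arc decorrelation hypothesis in the efficient (m,m′) frame: for a shift c ≠ 0,
dilations 1 ≤ n ≠ n′ ≤ 2M, Q = ⌊√M⌋+1,
the coset sums T_j = Σ_{m≡m′ (j)} λ(mn+c)λ(m′n′+c) (j ∈ [Q,2Q)) and the fan sums R_k = Σ_{j∈[Q,2Q)}
Σ_{m−m′=kj} λ(mn+c)λ(m′n′+c)
(k ≠ 0) are ≤ C·M^{3/4+ϑ} for some ϑ < 1/4 (random size M^{3/4}, trivial M^{3/2}). MAD alone gives —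
by provable glue —
power-saving dilated two-point Chowla (node DilatedChowla), power-saving Type II for λ(mn+c) on the
whole balanced range (node
TypeIILiouville), Bombieri–Vinogradov at level x^{ε₀} for the sequence Λ(n)λ(n+h) (node
LambdaLiouvilleLevel), hence μ ⟂ (dilated)
shifted primes with no EH at all (the parked support LevelToMobius of NOT DECOMPOSED YET); MAD ∧
ElliottHalberstam (the
Elliott–Halberstam conjecture Literature.NumberTheory.Sieve.LevelOfDistribution.ElliottHalberstam by
name, the route's declared
condition and a listed crux) gives Hardy–Littlewood pairs at every fixed shift (LevelToPairs =
Murty–Vatwani in λ-form); and the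
passage pairs → GHL (k ≥ 3, general slopes, shift-uniformity, d ≥ 2) is the GHL-hard complementary
sector — verbatim the shared
statement PairsToGHL (stmt-Parity-9389 of RoughSemiprimeRigidity, HullDial, LiouvilleShiftedTables),
carried on this route since
the crux-only repair of 2026-08-16 as the last conjunct of the rank-9 crux EngineToGHL (the 7-crux
cap leaves it no separate slot), so
that `closes` literally concludes GeneralizedHardyLittlewood.
Lean: `CosetDecorrelation ∧ FanDecorrelation ∧ ElliottHalberstam ∧ EngineToGHL`

## Assembly
DECIDING THEOREM (glue.lean; kernel-checked, pure logic; CRUX-ONLY since the repair of 2026-08-16 —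
every hypothesis is a
crux item and every declared crux lies in its cone):
`theorem closes (h₁ : CosetDecorrelation) (h₂ : FanDecorrelation) (hEH : ElliottHalberstam) (hX :
EngineToGHL) :
GeneralizedHardyLittlewood := hX.2.2.2.2 (hX.2.2.2.1 (hX.2.2.1 (hX.2.1 (hX.1 h₁ h₂))) hEH)`.
Here ElliottHalberstam := the Literature constant LevelOfDistribution.ElliottHalberstam (the
declared conditional_on, crux
stmt-Parity-14092) and EngineToGHL := (CosetDecorrelation → FanDecorrelation → DilatedChowla) ∧
(DilatedChowla → TypeIILiouville) ∧
(TypeIILiouville → LambdaLiouvilleLevel) ∧ (LambdaLiouvilleLevel → ElliottHalberstam → PairsHL) ∧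
(PairsHL → GeneralizedHardyLittlewood)
is the route's whole downstream of MAD ∧ EH as ONE crux: conjuncts 1–4 are DEFINITIONALLY the four
routine reductions
DecorrelationToDilatedChowla, DilatedChowlaToTypeII, TypeIIToLevel, LevelToPairs (each still a
separately closable SUPPORT item,
inlined only because the gate renders cruxes before supports; sorry-free candidate proofs are
attached to the two S-sized ones)
and conjunct 5 is the complementary sector. The term threads the nodes — hX.1 h₁ h₂ : DilatedChowla
(DivisorSwitch), hX.2.1 _ : TypeIILiouville
(Cauchy–Schwarz), hX.2.2.1 _ : LambdaLiouvilleLevel (Vaughan/Heath-Brown with Bombieri–Vinogradov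
for λ, a PROVED tree
theorem: LiouvilleShiftedTables.BVLiouville, Theorems/LiouvilleShiftedTablesBVLiouville — invoked
inside that proof, no longer
an item or an import of this route), hX.2.2.2.1 _ hEH : PairsHL (Murty–Vatwani with EH), hX.2.2.2.2
_ : GHL. END FORM once the
four supports are proved (tenure then restates EngineToGHL ↦ the shared PairsToGHL): `closes h₁ h₂
hEH hR := hR (LevelToPairs_holds
(TypeIIToLevel_holds (DilatedChowlaToTypeII_holds (DecorrelationToDilatedChowla_holds h₁ h₂)))
hEH)`. DilatedChowla,
TypeIILiouville and LambdaLiouvilleLevel are nodes (cruxes by grade, D-0018 NOTE 3), in the cone but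
not hypotheses; the item
`Assembly` is the type of `closes`.

CONDITIONAL on Literature.NumberTheory.Sieve.LevelOfDistribution.ElliottHalberstam — this route is an explicit reduction to that named conjecture (D-0019: crux floor waived).

Rationale: WHY THIS LINE. Pitt's cusp-form analogue of the Titchmarsh divisor problem (Pitt2012) shows the
architecture closes when the parity-carrying coefficient is kept whole and the Type-II step Σ_m|Σ_n
β_n a(mn+h)|² is won through shifted convolution sums by the DFI δ-symbol
(DukeFriedlanderIwaniec1994) + Voronoi + Kuznetsov; for Liouville λ every
step survives except Voronoi, and the card isolates the ONE additive statement the δ-method consumes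
— decorrelation of
the Liouville exponential sums along two progressions across the Farey points of one denominator j ≍
√M — which in the
(m,m′) frame is an exact elementary divisor-switching identity |J|·S = Σ_j T_j − Σ_{k≠0} R_k
(DivisorSwitch), so that
ϑ < 1/4 on cosets and fans is power-saving two-point Chowla for every dilated pair and, by
Cauchy–Schwarz, exactly the
bilinear, main-term-free, parity-sensitive Type-II information for λ(mn+c) that Polymath8b2014 §8
p.36 and Harman2007
§14.2 p.286 name as the missing input ("no Type II information at all"). New here: the Type-II
output is packaged as Bombieri–Vinogradov at level x^{ε₀} for Λ(n)λ(n+h) (Heath-Brown identity + BV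
for λ as the only Type-I input, aggregated over small moduli by Cauchy–Schwarz on multiplicities) —
precisely the λ-form of Vatwani's conjecture CE at level x^ε (Vatwani2016 ch. 7, pp.161–164;
MurtyVatwani2017), so Murty–Vatwani's
theorem "EH ∧ CE ⇒ Σ_{p≤x}Λ(p+2) ∼ 2C₂ li x" (Vatwani2016 Thm 7.1.2, §7.4 pp.177–186; Newman1980)
becomes provable glue (LevelToPairs): the route reaches PairsHL with EH as its only prime-side
conjecture; GHL is then reached through the residual pairs → GHL (the shared statement PairsToGHL,
here conjunct 5 of the crux EngineToGHL), the accepted D-0027 pattern.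
Imported: GL(2) shifted-convolution technology as architecture (DFI, Pitt, HeathBrown1996Crelle481),
the square-root law of the random model as calibration (MatomakiRadziwillTao2015 / TaoFMP2016:
proved is o(), log-averaged, never a power), level-of-distribution bookkeeping
(BombieriFriedlanderIwaniecActa1986, Vaughan1980, Heathbrown1982). Other routes:
RoughSemiprimeRigidity pays parity at a rough almost-prime cell under GEH; LiouvilleShiftedTables
posits λ far from rank one on dilated tables; only this one posits a λ-only, kit-testable hypothesis
at ONE Farey denominator; no item has a free window parameter (negatives index).

RANKED CRUXES. (repairs of 2026-08-16, D-0018 NOTE 3: every conjecture-grade statement on the route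
is a crux; the declared condition ElliottHalberstam is a listed crux; the complementary sector
PairsToGHL (stmt-Parity-9389, shared) is carried verbatim as conjunct 5 of the rank-9 crux
EngineToGHL since the crux-only repair — the 7-crux cap leaves it no separate slot — so the bridge
is a component of a full route. STAFFING ORDER = the MAD cruxes #2–#4 only; #5 is the named
conjecture; at rank 9 TypeIILiouville and LambdaLiouvilleLevel are nodes and EngineToGHL is worked
only through its four SUPPORT conjuncts — ranks are immutable after filing, hence the numbering.) #2
CosetDecorrelation (crux) — MAD proper (card item 3; = retired stmt-Parity-8050 verbatim). For every
shift c ≠ 0 there are ϑ < 1/4 and C such that for all M, all dilations 1 ≤ n ≠ n′ ≤ 2M and all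
moduli j ∈ [Q,2Q), Q = ⌊√M⌋+1: |Σ_{m,m′∈(M,2M], m≡m′ (mod j)} λ(mn+c)λ(m′n′+c)| ≤ C·M^{3/4+ϑ}.
Equivalently Σ_{a mod j} G_n(a/j)·conj G_{n′}(a/j) ≪ j·M^{3/4+ϑ}, G_n(α) = Σ_{m∼M} λ(mn+c)e(αm):
decorrelation across the Farey points of ONE denominator j ≍ √M (c = 0 or n = n′ excluded: T_j would
be a variance ≈ M^{3/2}/j). (why it might fail: Beyond GRH: each class sum is λ on an AP of modulus
jn ≥ √M with (modulus)² > size, so only the signed sum over classes can cancel; the random model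
leaves √(log M) of room below M^{3/4}, and a Landau–Siegel character χ₁ mod q∣j, q ≤ M^{1/4−ϑ},
would force T_j ≈ M^{3/2}/(jq).) [Pitt2012, DukeFriedlanderIwaniec1994, Polymath8b2014, Harman2007,
TaoTeravainen2021, Montgomery1971]
#3 FanDecorrelation (crux) — the complementary-divisor half of the δ-method (= retired
stmt-Parity-8051 verbatim). Same quantifiers; for every k ≠ 0: |Σ_{j∈[Q,2Q)} Σ_{m,m′∈(M,2M],
m−m′=kj} λ(mn+c)λ(m′n′+c)| ≤ C·M^{3/4+ϑ}. Dually R_k averages the dilated two-point sums A(d) = Σ_m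
λ(mn+c)λ(mn′+c−dn′) over ≍ √M second shifts d in progression; square-root cancellation in the signed
average is asked (fan empty for |k| > M/Q). (why it might fail: Decoupling λ(mn+c) from the √M-term
progression sums by Cauchy–Schwarz caps any proof at M^{5/4} even under GRH, so genuinely bilinear
cancellation is needed; Matomäki–Radziwiłł–Tao averaging gives o(M^{3/2}), never M^{3/4+ϑ}; same
Siegel caricature as for cosets.) [MatomakiRadziwillTao2015, MatomakiRadziwillAnnals2016,
DukeFriedlanderIwaniec1994, TaoFMP2016]
#4 DilatedChowla (crux) — the node the engine delivers and the sieve consumes (= retired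
stmt-Parity-8052): power-saving two-point Chowla for DILATED pairs, uniform in the dilations. For
every c ≠ 0 there are κ > 0 and C with |Σ_{m∈(M,2M]} λ(mn+c)λ(mn′+c)| ≤ C·M^{1−κ} for all M and all
1 ≤ n ≠ n′ ≤ 2M. Implied by cruxes 2 ∧ 3 with κ = 1/4 − ϑ (DecorrelationToDilatedChowla); a crux so
that other engines and refuters engage the OUTPUT; no window parameter. (why it might fail: Power
savings in λ-correlations are GRH-deep: a zero β > 1−κ/2 of ζ or of L(s,χ), χ mod nn′, heuristically
leaves a term M^{2β−1} (cf. Bhowmik–Ruzsa for Goldbach averages); only the log-averaged o() is known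
(Tao FMP 2016 Thm 1.2); uniformity n,n′ ≤ 2M is level 1/2.) [TaoFMP2016, BhowmikRuzsa2018,
HelfgottRadziwill2021, Literature.Barriers.Parity.GoldbachAverageZeros]
#5 ElliottHalberstam (crux — the declared condition BY NAME = stmt-Parity-14092, shared with
LiouvilleShiftedTables; a named open conjecture, NOT a staffing target) —
Literature.NumberTheory.Sieve.LevelOfDistribution.ElliottHalberstam := ∀ θ < 1, PrimesHaveLevel θ
(Σ_{q ≤ x^{θ−ε}} max_{y≤x} max_{(a,q)=1} |ψ(y;q,a) − y/φ(q)| ≪_A x(log x)^{−A}; Polymath 8b Claim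
2.2); the route's conditional_on constant is literally this crux (the verbatim spelling EH =
stmt-Parity-11314 was dropped here). Hypothesis hEH of `closes`, consumed only by LevelToPairs on
the prime side of Murty–Vatwani's split; only θ < 1/2 is known (tree:
BombieriVinogradovStatement_holds). (why it might fail: open for every θ > 1/2 — the large sieve
stops at level 1/2 (Literature.Barriers.Parity.LargeSieveLevelHalf), dispersion reaches 4/7 only for
well-factorable weights and one fixed residue (BFI 1986 Thm 10), and the level-x(log x)^{−B} version
is false (Friedlander–Granville 1989).) [ElliottHalberstam1970, Polymath8b2014,
BombieriFriedlanderIwaniecActa1986, FriedlanderGranville1989,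
Literature.Barriers.Parity.LargeSieveLevelHalf]
#9 TypeIILiouville (crux by grade — gate auto-crux, rank 9; node) — power-saving Type II for λ(mn+c)
on the balanced range (= retired stmt-Parity-8055; short n ≤ long m, dyadic boxes, arbitrary real
coefficients): for c ≠ 0 there are η > 0, C with |Σ_{m∈(M,2M]}Σ_{n∈(N,2N]} α_m β_n λ(mn+c)| ≤
C‖α‖₂‖β‖₂ (MN)^{1/2}(N^{−1/2} + M^{−η}) whenever 1 ≤ N ≤ M. The bilinear, main-term-free,
parity-sensitive input Polymath 8b §8 and Harman §14.2 ask for; open on its own, implied by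
DilatedChowla (DilatedChowlaToTypeII), so a direct attack is the same problem as cruxes 2–4. (why it
might fail: no Type-II bound for λ(mn+c) is known in any range — Harman §14.2: none at all for p+2 —
and a saving M^{−η} uniform in the coefficients is GRH-strength: a zero β > 1−2η of some L(s,χ), χ
mod n, biases λ along n-progressions; Matomäki–Radziwiłł–Tao give only o(1), log-averaged.)
[Harman2007, Polymath8b2014, MatomakiRadziwillTao2015, FordMaynard2024PrimeSieves,
BourgainSarnakZiegler2013]
#9 LambdaLiouvilleLevel (crux by grade — gate auto-crux, rank 9; node) — Bombieri–Vinogradov at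
level N^{ε₀} for the sequence Λ(n)λ(n+h): for every h ≠ 0 there is ε₀ > 0 such that for every A:
Σ_{q ≤ N^{ε₀}} |Σ_{n ≤ y_q, n ≡ w_q (mod q)} Λ(n)λ(n+h)| ≤ C·N/(log N)^A for N ≥ N₀ and every choice
of one residue w_q and one height y_q ≤ N per modulus. The q = 1 term alone is "λ ⟂ shifted primes"
with a log-power saving (open: parity); the level-N^{ε₀} average is the λ-form, with Λ-weights, of
Vatwani's CE at level x^ε. OUTPUT of the engine (TypeIIToLevel, from TypeIILiouville with the PROVED
tree theorem BV-for-λ), INPUT of LevelToPairs; not for direct attack. (why it might fail: already q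
= 1, Σ_{n≤N} Λ(n)λ(n+h) ≪ N(log N)^{−A}, is the open 'λ ⟂ shifted primes' problem — known only on
average over h (Lichtman2020; Lichtman–Teräväinen 2022 Thm 1.2) — and q ≤ N^{ε₀} adds BV-uniformity
nobody has for such correlations.) [Lichtman2020, arXiv:2111.08912, Vatwani2016, MurtyVatwani2017,
Harman2007]
#9 EngineToGHL (crux — ONE-PIECE DOWNSTREAM, added by the crux-only repair of 2026-08-16: only crux
items may be hypotheses of `closes`; 7-crux cap full; rendered after the two nodes) — EngineToGHL :=
(CosetDecorrelation → FanDecorrelation → DilatedChowla) ∧ (DilatedChowla → TypeIILiouville) ∧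
(TypeIILiouville → LambdaLiouvilleLevel) ∧ (LambdaLiouvilleLevel → ElliottHalberstam → PairsHL) ∧
(PairsHL → GeneralizedHardyLittlewood): conjuncts 1–4 are DEFINITIONALLY the support items
DecorrelationToDilatedChowla, DilatedChowlaToTypeII, TypeIIToLevel, LevelToPairs (inlined because
the gate renders cruxes before supports; candidate proofs attached to 1, 2; 3, 4 are L-sized
known-method reductions), conjunct 5 is the complementary sector — fixed-shift Hardy–Littlewood
pairs → GHL (Green–Tao Conj. 1.2, all d, t, L, convex K), verbatim the shared statement PairsToGHL
(stmt-Parity-9389 of RoughSemiprimeRigidity, HullDial, LiouvilleShiftedTables): GHL minus the pair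
case — prime k-tuples, k ≥ 3 (a k-fold engine needs 'tuple-EH' and λ ⟂ prime (k−1)-tuples in APs),
general slopes, shift-uniformity |b_i| ≤ LN (Landau–Siegel-hard, MatomakiMerikoski2023 Thm 1.3),
fibration d ≥ 2 ⇐ d = 1 — NOT reached by the MAD mechanism, true iff GHL is. once conjuncts 1–4
land, tenure restates EngineToGHL ↦ the shared PairsToGHL and `closes` to its END FORM; not a
staffing target as a whole. (why it might fail: conjunct 5 contains prime k-tuples and Siegel-hard
shift-uniformity; conjuncts 3–4 can fail AS STATED at the junctions — one-residue BV-λ vs the τ(r)²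
multiplicity of (d,q) ↦ lcm(d,q), moduli ek² ≤ 2N^{ε₀/2}log¹⁰N inside level N^{ε₀}, the
singular-series identity.) [GreenTao2010, MatomakiMerikoski2023, HardyLittlewood1923, Vaughan1980,
Heathbrown1982, MurtyVatwani2017, Vatwani2016]
SUPPORT (rank 9, routine; anyone idle may prove them): DivisorSwitch — the δ-method as an exact
elementary identity (DFI divisor switching, sharp weights): ∀ f : ℕ → ℕ → ℝ, ∀ M Q, |J|·Σ_{m∈(M,2M]}
f(m,m) + Σ_{0<|k|≤M} Σ_{j∈J} Σ_{m−m′=kj} f(m,m′) = Σ_{j∈J} Σ_{m≡m′ (mod j)} f(m,m′), J = [Q,2Q)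
(candidate proofs attached) [DukeFriedlanderIwaniec1994, HeathBrown1996Crelle481,
IwaniecKowalski2004]. DecorrelationToDilatedChowla — CosetDecorrelation → FanDecorrelation →
DilatedChowla by DivisorSwitch with f(m,m′) = λ(mn+c)λ(m′n′+c), Q = ⌊√M⌋+1 (fans empty for |k| >
M/Q; κ = 1/4 − max ϑ; candidate proofs attached) [DukeFriedlanderIwaniec1994, Pitt2012].
DilatedChowlaToTypeII — DilatedChowla → TypeIILiouville by Cauchy–Schwarz over the long variable (η
= κ/2; candidate proofs attached) [Harman2007, IwaniecKowalski2004]. BV for λ at level x^{1/2−ε}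
(one residue and one height per modulus), formerly the item BombieriVinogradovLiouville
(stmt-Parity-13324), is a PROVED tree theorem — LiouvilleShiftedTables.BVLiouville ←
Theorems/LiouvilleShiftedTablesBVLiouville (stub_bvLiouville of line peel-to-drappeau; BFI Thm 0(b)
+ Heath-Brown + Siegel–Walfisz for λ) — no longer an item here (its `_holds` link imported that
Theorems module, whose import closure via FouvryTenenbaumLiouvilleProofs put 29 unproved wave-0
named facts of RHWave0/ParityWave0/GeneralizedRH into the module cone); provers import it in
Theorems files [BombieriFriedlanderIwaniecActa1986, IwaniecKowalski2004, Vaughan1980,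
Heathbrown1982, Bombieri1965]. TypeIIToLevel — TypeIILiouville → LambdaLiouvilleLevel (restated
2026-08-16 without the BV-λ hypothesis, now a theorem used inside the proof; Vaughan/Heath-Brown
identity with U = V = N^{1/10} inside each class mod q ≤ N^{ε₀}; Type I aggregated over pairs (d,q)
with lcm(d,q) ≤ N^{1/5+ε₀} by BV for λ in max form and Cauchy–Schwarz on multiplicities τ(r)²; Type
II classes ≤ qτ(q), cut removed by N^{−ηu/3}-subdivision; ε₀ < η/45) [Vaughan1980, Heathbrown1982,
Harman2007, IwaniecKowalski2004, BombieriFriedlanderIwaniecActa1986]. LevelToPairs — Murty–Vatwani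
in λ-form with Λ-weights: LambdaLiouvilleLevel → ElliottHalberstam → ∀ h ≥ 1, Σ_{n≤N} Λ(n)Λ(n+h) =
𝔖({0,h})·N + o(N) (Vatwani2016 §7.4 transposed: Λ(n+h) = Σ_{de=n+h} μ(d) log e; d ≤ N^{1−ε₁} by EH
at θ = 1−ε₁/2 with main term −N·Σ_{(d,h)=1} μ(d)log d/φ(d) = 𝔖({0,h})·N via Newman1980 /
tendsto_singularSeriesPartial; d > N^{1−ε₁} via μ = λ·Σ_{k²∣·}μ(k), K = log⁵N and
LambdaLiouvilleLevel at moduli ek²) [Vatwani2016, MurtyVatwani2017, Newman1980, HardyLittlewood1923,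
HalberstamRichert1974]. ASSEMBLY (rank 1, = the type of `closes`): CosetDecorrelation →
FanDecorrelation → ElliottHalberstam → EngineToGHL → GeneralizedHardyLittlewood.

TWO-LAYER PLAN. Foreseen glued splits (k ≤ 3, depth 1), filed only when a crux closes or stalls with
a census: CosetDecorrelation ⇐ CosetSmallDilations (n,n′ ≤ √M — the card's lopsided regime, enough
for Type II on [x^δ,x^{1/3}], hence for LambdaLiouvilleLevel and, by Harman's comparison sieve with
uncovered Buchstab mass log 2 < 1, for both signs of λ(p+2) with density ≥ (1−log 2)/2) →
CosetLargeDilations (√M < n,n′ ≤ 2M) → CosetDecorrelation, same for FanDecorrelation; TypeIIToLevel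
⇐ TypeIAggregate (Cauchy–Schwarz on multiplicities over pairs (d,q)) → TypeIIClasses →
TypeIIToLevel; LevelToPairs ⇐ SingularSeriesIdentity (−Σ_{(d,h)=1} μ(d)log d/φ(d) = singularSeries
{0,h}; Σ_{d≤D,(d,h)=1} μ(d)/φ(d) ≪ log^{−2}D) → TypeITail → LevelToPairs. EngineToGHL is never split
(its conjuncts are items).

KILL CRITERIA. CosetDecorrelation or FanDecorrelation REFUTED substantively for some c — a family
(M, n, n′, j or k) with |T_j| or |R_k| ≥ M^{1−o(1)} — closes the route (`close --reason
refuted:<Decl>`); a refutation living in an explicit thin family (q ∣ j for an exceptional modulus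
q, or j tied to n′ − n) is `misstated`: add the repaired statement as a new item once, never reword
in place. DilatedChowla refuted (|S(n,n′;M)| ≥ M^{1−o(1)} along a sequence)
closes the route outright — both decorrelations die with it by DivisorSwitch; TypeIILiouville or
LambdaLiouvilleLevel
refuted substantively likewise (each is implied by the cruxes plus the tree theorem BV-for-λ). A
THEOREM "DilatedChowla (or MAD) ⇒ quasi-RH" does not refute but re-grades the route
CONDITIONAL(GRH+): record it next to Literature.Barriers.Parity.GoldbachAverageZeros, keep only the
provable items staffed. The support glue items (= conjuncts 1–4 of EngineToGHL) are
identities/bookkeeping/known-method reductions: a refutation means a misstatement — file the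
repaired item and re-conjoin EngineToGHL on it, never close. ElliottHalberstam refuted (some θ₀ < 1
with no level x^{θ₀}) kills this route with every EH-bridge (LiouvilleShiftedTables,
RoughSemiprimeRigidity); conjunct 5 of EngineToGHL (= PairsToGHL) cannot be refuted without refuting
GHL (the sub-problem is then decided negatively anyway). PairsHL proved elsewhere ⇒ close
`superseded --by` that route; GHL decided through DimOne (DicksonFibration) ⇒ close superseded.

NOT DECOMPOSED YET. PARKED (dropped by the badge repair; re-file as SUPPORT with the signature of
stmt-Parity-13328 once LambdaLiouvilleLevel is proved or staffed): LevelToMobius, the EH-FREE payoff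
LambdaLiouvilleLevel → (i) ∀ m, h ≥ 1, Σ_{d≤x} μ(d)Λ(dm+h) = o(x) (atom stmt-Parity-0612) ∧ (ii) ∀ h
≥ 1, Σ_{p≤X} μ(p+h) = o(π(X)) (Möbius ⟂ shifted primes, Lichtman2020 p.1) — a routine M-sized
implication (μ = λ·Σ_{k²∣·}μ(k), K = log²x, LambdaLiouvilleLevel at moduli mk² resp. k²) outside
`closes`, auto-badged crux only because its conclusion quotes an open statement. The spectral form
of CosetDecorrelation (characters mod jn, jn′, explicit formula for Σλχ as the "Voronoi" step: T_j
as a bilinear form in zero-sums of DISTINCT Dirichlet L-functions — the card's GRH-conditional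
log-power foothold via 2-level densities, already giving LambdaLiouvilleLevel's q = 1 case); smooth
weights / the u-twisted δ-symbol version (not needed in the (m,m′) frame); the lopsided/Harman sign
theorem for λ(p+2)
(layer-2 child above); the k-tuple analogue hidden in the pairs → GHL conjunct of EngineToGHL (NOT
reachable by bilinear λ(mn+h) information); uniformity in the shift c and in h ≤ (log N)^C;
effective constants (BV for λ and EH are Siegel-ineffective); the balance "BV (θ = 1/2) +
LambdaLiouvilleLevel at level 1/2+ε" which would remove EH but is blocked inside TypeIIToLevel
(Type-I moduli lcm(d,q) > x^{1/2}); kit numerics at scale (M = 10⁵–10⁶, n ∼ M).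

CHEAPEST FALSIFIER. (i) Numerics (kit): max_j |T_j|/M^{3/4} and max_k |R_k|/M^{3/4} for c ∈ {±1, 2},
(n,n′) ∈ {(1,2),(2,3),(3,7),(1,5)}
and n ∼ M/2, n ∼ M, M = 10⁴…10⁶ (segmented λ-sieve to 4M²): growth like M^{η} with η near 1/4 kills
the usable range of ϑ. Pure-Python runs at open (M = 600, 2000; 18 triples (c,n,n′) incl. n ∼ M/2, n
∼ M): max|T_j|/M^{3/4} ∈ [1.3, 3.3], max|R_k|/M^{3/4} ∈ [1.2, 3.4], |S|/√M ≤ 1.9, DivisorSwitch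
exact — square-root law, constant ≈ 1, no drift between the scales.
(ii) One page of logic: does DilatedChowla ∧ BV ⇒ a zero-free half-plane (Bhowmik–Ruzsa's kernel
argument for ΣΛ(n)λ(n+c), or the explicit formula for Σ_m λ(mn+c)λ(mn′+c) via L(s,χ) mod nn′)? A yes
re-grades the route GRH+-conditional, does not close it. (iii) For the glue: check numerically that
−Σ_{d≤D,(d,2)=1} μ(d) log d/φ(d) →
2C₂ = 1.3203… (D = 10⁶; Vatwani2016 Lemma p.180) in the tree's normalisation singularSeries {0,2} =
2·twinPrimeConst.

NUMBERS. Sizes in the (m,m′) frame, Q = ⌊√M⌋+1: T_j has ≈ M²/j ∈ [M^{3/2}/2, M^{3/2}] terms, R_k ≤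
M^{3/2}; random size M^{3/4};
needed ≤ M^{1−ε}; rooms M^{q/2}, M^{3q/2−1/2} for Q = M^q are equal only at q = 1/2 (√M optimal; no
Q lets a log-power hypothesis suffice). Card dictionary: MAD_θ at q ≍ √(nn′M) ↔ ϑ = θ/2; dilations ≤
M^ρ give Type II for N ≤ x^{ρ/(1+ρ)} (ρ = 1/2: x^{1/3}, the card; ρ = 1: x^{1/2}, filed). Type II
saving N^{−1/2} + M^{−κ/2}, κ = 1/4 − ϑ; Vaughan U = V = x^{1/10}; level of LambdaLiouvilleLevel:
any ε₀ < η/45, η = κ/2 (crude). Murty–Vatwani: d < x^{1−ε} under GEH(θ) ∀θ<1, tail via CE at level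
x^ε, |S₂| ≪ x^{ν₀} (Vatwani2016 p.186); 2C₂ = 1.32032… (p.181). Known: BV θ < 1/2 (tree, PROVED);
Lichtman2020 Thm 1.1 (h-average); TaoFMP2016 Thm 1.2 (log-averaged dilated pairs); Harman2007 p.286
(no Type II for p+2). Items: 15 at open, 16, 14, then 13 since the crux-only repair of 2026-08-16: 7
cruxes (3 MAD at ranks 2–4, ElliottHalberstam 5, nodes TypeIILiouville, LambdaLiouvilleLevel and
EngineToGHL 9), 5 support (DivisorSwitch, DecorrelationToDilatedChowla, DilatedChowlaToTypeII: S,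
candidate proofs attached; TypeIIToLevel, LevelToPairs: L), 1 assembly; BombieriVinogradovLiouville
(proved) now cited as a tree theorem, PairsToGHL folded into EngineToGHL. `closes`: 4 hypotheses,
all cruxes (CosetDecorrelation, FanDecorrelation, ElliottHalberstam, EngineToGHL), every declared
crux in its cone; imports: SingularSeries (+ conditional_on auto-import LevelOfDistribution).

DEFINITION REQUESTS. None. ArithmeticFunction.liouville / vonMangoldt, Nat.sqrt, Nat.ModEq are
Mathlib; Literature.NumberTheory.Sieve.singularSeries and LevelOfDistribution.ElliottHalberstam
exist. No cite facts wanted: every non-conjectural input (BV for primes, BFI Theorem 0(b),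
Siegel–Walfisz for μ/λ, Heath-Brown identity, GT Lemma 1.3) is in tree; BV for λ is PROVED in tree
(LiouvilleShiftedTables.BVLiouville ← Theorems/LiouvilleShiftedTablesBVLiouville @ 7013b04e1aff;
import it in Theorems files only, never in this route file).

Novelty: Searches (2026-08-15, this seat): `lit search --hybrid "bilinear sums Liouville function shifted
products type II estimate
parity twin primes"` (12 book rows, vector leg only — Harman2007, Iwaniec2002, Cojocaru–Murty;
nothing on λ(mn+h));
`lit search --source zbmath "twin primes parity problem Murty Vatwani"` (1:
doi:10.1016/j.jnt.2017.05.011 =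
MurtyVatwani2017); `--source zbmath "Liouville function bilinear sums"` (2: Timofeev 1993
doi:10.1007/bf01208394 on
multiplicative functions with shifted arguments — one variable; irrelevant second hit); `--source
zbmath "delta method
shifted convolution Möbius"` (0); `--source crossref "bilinear forms Liouville function shifted
product delta method"` (8,
only Diao 2026 doi:10.1017/s0017089526101074 on λ/Λ at random binary forms is adjacent; not bilinear
in our sense);
`--source arxiv` two queries (0 rows each; API returned nothing), OpenAlex/S2 rate-limited (429) —
recorded; `lit galaxy
search --star all` on "Mobius function over shifted primes in arithmetic progressions", "Liouville
function at shifted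
primes", "twin primes and the parity problem" (0/0/0 each); `lit frontier Parity --since 2022` (30
rows: arXiv:2501.10962
variants of Chowla, arXiv:2409.02106 correlations of μ/λ with partial sums, Invent. 2026 higher
uniformity II — none on
bilinear λ(mn+h) or on MAD); `lit read paper:w2557492421` (Vatwani2016) ch. 7 pp.161–164, 177–187
(CE(θ), GEH(θ), Thm
7.1.2, the S₁/S₂ split, Newman's Tauberian main term, CE†/CE* variants p.186–18  [refs: 10.1016/j.jnt.2017.05.011, 10.1007/bf01208394, 10.1017/s0017089526101074, 10.1090/s0894-0347-2012-00750-4:, 2501.10962, 2409.02106, 2009.08969, doi:10.1016/j.jnt.2017.05.011, doi:10.1007/bf01208394, doi:10.1017/s0017089526101074, paper:w2557492421, doi:10.1090/s0894-0347-2012-00750-4, Harman2007, Iwaniec2002, MurtyVatwani2017, Vatwani2016, Pitt2012, Lichtman2020, DukeFriedlanderIwaniec1994]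

Barriers (technique_class: delta-method type-II liouville bilinear-decorrelation): - technique_class: delta-method type-II liouville bilinear-decorrelation
- Literature.Barriers.Parity.CircleMethodBinaryBarrier: the barrier kills minor-arc treatments by
SIZE (|S|, L², large sieve); the route's circle method is the divisor-switch identity and its
hypothesis MAD is a PHASE statement — signed cancellation in Σ_{a mod j} G_n(a/j)·conj G_{n′}(a/j)
and in signed fan averages — exactly the "cancellation in the arguments on the minor arcs" the
barrier's sources leave open; conceded: it is a hypothesis, not a theorem.
- Literature.Barriers.Parity.SelbergParityBarrier: Type-I information of any level leaves
ΣΛ(n)λ(n+c) undetermined (Bombieri indeterminacy); the decisive input here is bilinear and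
parity-SENSITIVE (TypeIILiouville fails for Selberg's ghosts 1 ± λ), so the line is outside the
barrier's Type-I class; EH enters only on the prime side of Murty–Vatwani's split, where parity has
already been paid by λ.
- Literature.Barriers.Parity.PrimePairParity: the weight-insertion test fails for the route's input
— ω = 1 − λ(n)λ(n+2) is not a function of the product mn + c, so Type II for λ(mn+c) is not
weight-insertion invariant; it is the "bilinear expressions" exit Polymath 8b §8 names, supplied
conditionally on MAD.
- Literature.Barriers.Parity.FordMaynardMinimalTypeII: respected, not evaded — some Type-II window
is necessary at Type-I level 1/2, and the route supplies the whole balanced window [x^δ, x^{1/2}]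
with a power saving.
- Literature.Barriers.Parity.FordMay

Novelty grade: new-combination — refuter g44-38. PRIOR ART (roles verified): Pitt2012 (GL(2) delta-symbol Type II) = the architecture; DukeFriedlanderIwaniec1994 = divisor switching (here the exact sharp-weight identity DivisorSwitch, machine-checked by me for M<=12, Q<=7); MurtyVatwani2017 / Vatwani2016 Thm 7.1.2 (GEH + CE => twin (refuter refuter-refute-pool-g44-38, 2026-08-15T19:13:33Z; prior: Pitt2012, DukeFriedlanderIwaniec1994, MurtyVatwani2017, Vatwani2016, Lichtman2020, Polymath8b2014, Harman2007)

History (route lifecycle, newest last):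
- 2026-08-16T03:31:44Z · rev 9: restated LevelToPairs (stmt-Parity-13327), Assembly (stmt-Parity-13329) — badge repair (rbadge-Parity-LiouvilleMAD-adc0542d), step 2 (step 1 = retriage at rev 8): restate LevelToPairs + Assembly on ElliottHalberstam (EH → ElliottHalbe (planner-rbadge-Parity-LiouvilleMAD-adc0542d-0)
- 2026-08-16T03:31:44Z · rev 9: dropped EH, LevelToMobius — badge repair (rbadge-Parity-LiouvilleMAD-adc0542d), step 2 (step 1 = retriage at rev 8): restate LevelToPairs + Assembly on ElliottHalberstam (EH → ElliottHalbe (planner-rbadge-Parity-LiouvilleMAD-adc0542d-0)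
- 2026-08-16T07:13:28Z · rev 17: dropped MADToGHL — route-repair rbadge g3, step 2a-fix: drop the just-added crux MADToGHL (stmt-Parity-14988) — the gate rendered it BLOCKED/TODO because a rank-8 crux is placed b (planner-rbadge-Parity-LiouvilleMAD-adc0542d-g3-0)
- 2026-08-16T07:17:29Z · rev 19: restated TypeIIToLevel (stmt-Parity-13326), Assembly (stmt-Parity-14551) — route-repair rbadge g3, step 2b/3 (glue crux-only + cone; EngineToGHL = stmt-Parity-14995 added in step 2a). (1) CRUX-ONLY closes (h₁ : CosetDecorrelation) (h₂ (planner-rbadge-Parity-LiouvilleMAD-adc0542d-g3-0)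
- 2026-08-16T07:17:29Z · rev 19: dropped PairsToGHL, BombieriVinogradovLiouville — route-repair rbadge g3, step 2b/3 (glue crux-only + cone; EngineToGHL = stmt-Parity-14995 added in step 2a). (1) CRUX-ONLY closes (h₁ : CosetDecorrelation) (h₂ (planner-rbadge-Parity-LiouvilleMAD-adc0542d-g3-0)
- 2026-08-24T01:15:30Z · DORMANT — reconciler: no traction for 6.4 d (last activity item-evidence-added at 2026-08-17T14:54:45Z); parked, not closed — `ledger route dormant route-Parity-Liouville (operator:999:954417)
- 2026-08-29T05:52:26Z · REACTIVATED — reconciler: reactivated — activity statement-checked at 2026-08-29T02:47:45Z after parking at 2026-08-24T01:15:30Z (operator:999:1670645)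
- 2026-09-03T09:42:47Z · DORMANT — reconciler: no traction for 5 d (last activity statement-checked at 2026-08-29T08:50:19Z); parked, not closed — `ledger route dormant route-Parity-LiouvilleMAD (operator:999:3923881)

sub-problem: GeneralizedHardyLittlewood · status: dormant · opened planner-plancard-Parity-GeneralizedHardyLittl-6d31bf21-g2-0 2026-08-15T19:01:10Z · rev 19 · ledger route-Parity-LiouvilleMAD
GENERATED by the gate from the ledger (D-0016/17). Provers cite these decls: `theorem foo : Summit.Parity.GeneralizedHardyLittlewood.Theses.LiouvilleMAD.<Decl> := …` in Summits/Parity/GeneralizedHardyLittlewood/Theorems/<Name>.lean.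
-/

namespace Summit.Parity.GeneralizedHardyLittlewood.Theses.LiouvilleMAD

open scoped BigOperators Topology Manifold Classical MeasureTheory ProbabilityTheory Matrix InnerProductSpace ComplexConjugate ContinuousMap
open Filter Set Function TopologicalSpace MeasureTheory

attribute [summit_statement] _root_.GeneralizedHardyLittlewood
attribute [route_premise "route-Parity-LiouvilleMAD"] _root_.Literature.NumberTheory.Sieve.LevelOfDistribution.ElliottHalberstam

/-! Retired items kept as plain definitions (history; not obligations of this route): landed proofs / closed glue still name them. -/

-- tombstone: stmt-Parity-13324 was DROPPED from this route but is still named by active items / landed proofs — kept as a plain def (no route_item tag), not an obligation of this route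
/-- retired stmt-Parity-13324 (dropped, gen None) — proved by Summit.Parity.GeneralizedHardyLittlewood.Cruxes.TypeI2Dilated.PeelToDrappeau.stub_bvLiouville @ 728982fbd7eb. -/
def BombieriVinogradovLiouville : Prop :=
  ∀ ε : ℝ, 0 < ε → ∀ A : ℝ, 0 < A → ∃ C x₀ : ℝ, ∀ x : ℝ, x₀ ≤ x → ∀ c : ℕ → ℤ, ∀ y : ℕ → ℝ, (∀ d, 1 ≤ d → 0 ≤ c d ∧ c d < d) → (∀ d, 0 ≤ y d ∧ y d ≤ x) → (∑ d ∈ Finset.Icc 1 ⌊x ^ (1 / 2 - ε)⌋₊, |∑ n ∈ Finset.Icc 1 ⌊y d / d⌋₊, (ArithmeticFunction.liouville (Int.toNat ((d : ℤ) * n + c d)) : ℝ)|) ≤ C * x / Real.log x ^ A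

/-- item stmt-Parity-13317 · crux · rank 2 · open · by planner
why it might fail: Beyond GRH: each class sum is λ on an AP of modulus jn ≥ √M with (modulus)² > size, so only the signed sum over classes can cancel; the random model leaves √(log M) of room below M^{3/4}, and a Landau–Siegel character χ₁ mod q∣j, q ≤ M^{1/4−ϑ}, would force T_j ≈ M^{3/2}/(jq).
sources: Pitt2012, DukeFriedlanderIwaniec1994, Polymath8b2014, Harman2007, TaoTeravainen2021, Montgomery1971
[crux] MAD proper (card item 3, efficient frame; = retired stmt-Parity-8050 verbatim). For every
shift c ≠ 0 there are ϑ < 1/4 and C such that for all M, all dilations 1 ≤ n ≠ n′ ≤ 2M and all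
moduli j ∈ [Q,2Q), Q = ⌊√M⌋+1: |Σ_{m,m′∈(M,2M], m≡m′ (mod j)} λ(mn+c)λ(m′n′+c)| ≤ C·M^{3/4+ϑ}.
Equivalently Σ_{a mod j} G_n(a/j)·conj G_{n′}(a/j) ≪ j·M^{3/4+ϑ} with G_n(α) = Σ_{m∼M} λ(mn+c)e(αm):
the Liouville exponential sums along the progressions c mod n and c mod n′ decorrelate across the
Farey points of ONE denominator j ≍ √M (c = 0 or n = n′ would make T_j a variance ≈ +M^{3/2}/j,
hence the exclusions). [difficulty: open-problem] -/
@[route_item "route-Parity-LiouvilleMAD"]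
def CosetDecorrelation : Prop :=
  ∀ c : ℤ, c ≠ 0 → ∃ ϑ : ℝ, ϑ < 1 / 4 ∧ ∃ C : ℝ, ∀ M n n' j : ℕ, 1 ≤ n → 1 ≤ n' → n ≠ n' → n ≤ 2 * M → n' ≤ 2 * M → Nat.sqrt M + 1 ≤ j → j < 2 * (Nat.sqrt M + 1) → |∑ p ∈ (Finset.Ioc M (2 * M) ×ˢ Finset.Ioc M (2 * M)).filter (fun p : ℕ × ℕ => p.1 ≡ p.2 [MOD j]), (ArithmeticFunction.liouville (Int.toNat ((p.1 : ℤ) * n + c)) : ℝ) * (ArithmeticFunction.liouville (Int.toNat ((p.2 : ℤ) * n' + c)) : ℝ)| ≤ C * (M : ℝ) ^ (3 / 4 + ϑ)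

/-- item stmt-Parity-13318 · crux · rank 3 · open · by planner
why it might fail: Decoupling λ(mn+c) from the √M-term progression sums by Cauchy–Schwarz caps any proof at M^{5/4} even under GRH, so genuinely bilinear cancellation is needed; Matomäki–Radziwiłł–Tao averaging gives o(M^{3/2}), never M^{3/4+ϑ}; same Siegel caricature as for cosets.
sources: MatomakiRadziwillTao2015, MatomakiRadziwillAnnals2016, DukeFriedlanderIwaniec1994, TaoFMP2016
[crux] the complementary-divisor half of the δ-method (card item 1's "trivial ranges", made
explicit; = retired stmt-Parity-8051 verbatim). Same quantifiers; for every k ≠ 0: |Σ_{j∈[Q,2Q)}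
Σ_{m,m′∈(M,2M], m−m′=kj} λ(mn+c)λ(m′n′+c)| ≤ C·M^{3/4+ϑ}. Dually R_k is an average, over ≍ √M second
shifts in arithmetic progression (difference k·n′), of the dilated two-point sums A(d) = Σ_m
λ(mn+c)λ(mn′+c−dn′). Square-root cancellation in the signed average is asked (random size M^{3/4};
the fan is empty for |k| > M/Q). [difficulty: open-problem] -/
@[route_item "route-Parity-LiouvilleMAD"]
def FanDecorrelation : Prop :=
  ∀ c : ℤ, c ≠ 0 → ∃ ϑ : ℝ, ϑ < 1 / 4 ∧ ∃ C : ℝ, ∀ M n n' : ℕ, ∀ k : ℤ, 1 ≤ n → 1 ≤ n' → n ≠ n' → n ≤ 2 * M → n' ≤ 2 * M → k ≠ 0 → |∑ j ∈ Finset.Ico (Nat.sqrt M + 1) (2 * (Nat.sqrt M + 1)), ∑ p ∈ (Finset.Ioc M (2 * M) ×ˢ Finset.Ioc M (2 * M)).filter (fun p : ℕ × ℕ => (p.1 : ℤ) - p.2 = k * (j : ℤ)), (ArithmeticFunction.liouville (Int.toNat ((p.1 : ℤ) * n + c)) : ℝ) * (ArithmeticFunction.liouville (Int.toNat ((p.2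 : ℤ) * n' + c)) : ℝ)| ≤ C * (M : ℝ) ^ (3 / 4 + ϑ)

/-- item stmt-Parity-13319 · crux · rank 4 · open · by planner
why it might fail: Power savings in λ-correlations are GRH-deep: a zero β > 1−κ/2 of ζ or of L(s,χ), χ mod nn′, heuristically leaves a term M^{2β−1} (cf. Bhowmik–Ruzsa for Goldbach averages); only the log-averaged o() is known (Tao FMP 2016 Thm 1.2); uniformity n,n′ ≤ 2M is level 1/2.
sources: TaoFMP2016, BhowmikRuzsa2018, HelfgottRadziwill2021, Literature.Barriers.Parity.GoldbachAverageZeros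
[crux] the node the engine delivers and the sieve consumes (= retired stmt-Parity-8052 verbatim):
power-saving two-point Chowla for DILATED pairs, uniform in the dilations. For every c ≠ 0 there are
κ > 0 and C with |Σ_{m∈(M,2M]} λ(mn+c)λ(mn′+c)| ≤ C·M^{1−κ} for all M and all 1 ≤ n ≠ n′ ≤ 2M.
Implied by cruxes 2 ∧ 3 with κ = 1/4 − ϑ (DecorrelationToDilatedChowla); filed as a crux so that
other engines and refuters engage the OUTPUT directly; n = 1 is Σ_k λ(k)λ(n′k + c(1−n′)). No window
parameter. [deps: CosetDecorrelation, FanDecorrelation] [difficulty: open-problem] -/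
@[route_item "route-Parity-LiouvilleMAD"]
def DilatedChowla : Prop :=
  ∀ c : ℤ, c ≠ 0 → ∃ κ : ℝ, 0 < κ ∧ ∃ C : ℝ, ∀ M n n' : ℕ, 1 ≤ n → 1 ≤ n' → n ≠ n' → n ≤ 2 * M → n' ≤ 2 * M → |∑ m ∈ Finset.Ioc M (2 * M), (ArithmeticFunction.liouville (Int.toNat ((m : ℤ) * n + c)) : ℝ) * (ArithmeticFunction.liouville (Int.toNat ((m : ℤ) * n' + c)) : ℝ)| ≤ C * (M : ℝ) ^ (1 - κ)

/-- item stmt-Parity-14092 · crux · rank 5 · open · by planner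
why it might fail: Open for every θ > 1/2: the large sieve stops at level 1/2 (Barriers.Parity.LargeSieveLevelHalf); dispersion reaches 4/7 only for well-factorable weights and one fixed residue (BFI 1986 Thm 10); the level-x(log x)^{−B} version is false (Friedlander–Granville 1989).
sources: ElliottHalberstam1970, Polymath8b2014, BombieriFriedlanderIwaniecActa1986, FriedlanderGranville1989, Literature.Barriers.Parity.LargeSieveLevelHalf
[crux] The Elliott–Halberstam conjecture BY NAME — the declared bridge premise of this CONDITIONAL
route, added as a crux by the route-choice repair (a) of 2026-08-16 (operator hold 'bridge-only':
the conditional-on constant must be one of the route's cruxes). Signature = the Literature constant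
Literature.NumberTheory.Sieve.LevelOfDistribution.ElliottHalberstam = ∀ θ < 1, PrimesHaveLevel θ,
i.e. ∀ A, ε > 0: Σ_{q ≤ x^{θ−ε}} max_{1≤y≤x} max_{(a,q)=1} |ψ(y;q,a) − y/φ(q)| ≪ x(log x)^{−A}.
Definitionally equal to the verbatim node EH (stmt-Parity-11314; `Iff.rfl`, planner Sketch.lean rc
0), which stays as the input of LevelToPairs; the deciding theorem `closes` takes THIS item (hEH :
ElliottHalberstam), so the route's dependence on the named conjecture is literal. Named open
conjecture — grounders stamp, provers/refuters do not spend effort; only θ < 1/2 is known (tree: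
BombieriVinogradovStatement_holds). why it might fail: open for every θ > 1/2 and beyond the
large-sieve method (Literature.Barriers.Parity.LargeSieveLevelHalf: both terms of Q²+N−1 are
necessary, so mean-value proofs stop at Q = x^{1/2}(log x)^{−B}); the x^{θ−ε}-level, (log
x)^{−A}-saving form is the standard believed -/
@[route_item "route-Parity-LiouvilleMAD"]
def ElliottHalberstam : Prop :=
  Literature.NumberTheory.Sieve.LevelOfDistribution.ElliottHalberstam

/-- item stmt-Parity-13322 · crux (kind.auto-crux: conjecture-grade) · rank 9 · open · by planner
why it might fail: No Type-II bound for λ(mn+c) is known in any range (Harman2007 §14.2: none at all for p+2); a saving M^{−η} uniform in the coefficients is GRH-strength — a zero β > 1−2η of some L(s,χ), χ mod n, biases λ along n-progressions — and MR–Tao give only o(1), log-averaged.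
sources: Harman2007, Polymath8b2014, MatomakiRadziwillTao2015, FordMaynard2024PrimeSieves, BourgainSarnakZiegler2013
[support] power-saving Type II for λ(mn+c) on the balanced range (= retired stmt-Parity-8055
verbatim; short variable n ≤ long variable m, dyadic boxes, arbitrary real coefficients): for c ≠ 0
there are η > 0, C with |Σ_{m∈(M,2M]}Σ_{n∈(N,2N]} α_m β_n λ(mn+c)| ≤ C‖α‖₂‖β‖₂ (MN)^{1/2}(N^{−1/2} +
M^{−η}) whenever 1 ≤ N ≤ M (trivial for N ≤ C²; sub-boxes by zero-extension). The bilinear,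
main-term-free, parity-sensitive input Polymath 8b §8 and Harman §14.2 ask for; an open problem on
its own, implied by DilatedChowla (support DilatedChowlaToTypeII). [difficulty: open-problem] -/
@[route_item "route-Parity-LiouvilleMAD"]
def TypeIILiouville : Prop :=
  ∀ c : ℤ, c ≠ 0 → ∃ η : ℝ, 0 < η ∧ ∃ C : ℝ, ∀ M N : ℕ, 1 ≤ N → N ≤ M → ∀ α β : ℕ → ℝ, |∑ m ∈ Finset.Ioc M (2 * M), ∑ n ∈ Finset.Ioc N (2 * N), α m * β n * (ArithmeticFunction.liouville (Int.toNat ((m : ℤ) * n + c)) : ℝ)| ≤ C * Real.sqrt (∑ m ∈ Finset.Ioc M (2 * M), α m ^ 2) * Real.sqrt (∑ n ∈ Finset.Ioc N (2 * N), β n ^ 2) * Real.sqrt ((M : ℝ) * N) * ((N : ℝ) ^ (-(1 / 2 : ℝ)) + (M : ℝ) ^ (-η))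

/-- item stmt-Parity-13325 · crux (kind.auto-crux: conjecture-grade) · rank 9 · open · by planner
why it might fail: Already q = 1, Σ_{n≤N} Λ(n)λ(n+h) ≪ N(log N)^{−A}, is the open 'λ ⟂ shifted primes' problem (parity-sensitive; known only on average over h — Lichtman2020, Lichtman–Teräväinen 2022 Thm 1.2); the sum over q ≤ N^{ε₀} adds BV-uniformity nobody has for such correlations.
sources: Lichtman2020, arXiv:2111.08912, Vatwani2016, MurtyVatwani2017, Harman2007
[support] NEW NODE — Bombieri–Vinogradov at level N^{ε₀} for the sequence Λ(n)λ(n+h): for every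
shift h ≠ 0 there is ε₀ > 0 such that for every A there are C, N₀ with Σ_{q ≤ N^{ε₀}} |Σ_{n ≤ y_q, n
≡ w_q (mod q)} Λ(n)λ(n+h)| ≤ C·N/(log N)^A for all N ≥ N₀ and all choices of one residue w_q and one
height y_q ≤ N per modulus (equivalently max over residues and heights). The q = 1 term alone is "λ
⟂ shifted primes" with a log-power saving (open: parity); the level-N^{ε₀} average is the λ-form,
with Λ-weights, of Vatwani's conjecture CE at level x^ε. OUTPUT of the engine (TypeIIToLevel), INPUT
of LevelToPairs (with EH) and LevelToMobius (no EH); not to be attacked directly. [difficulty: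
open-problem] -/
@[route_item "route-Parity-LiouvilleMAD"]
def LambdaLiouvilleLevel : Prop :=
  ∀ h : ℤ, h ≠ 0 → ∃ ε₀ : ℝ, 0 < ε₀ ∧ ∀ A : ℝ, 0 < A → ∃ C : ℝ, ∃ N₀ : ℕ, ∀ N : ℕ, N₀ ≤ N → ∀ w y : ℕ → ℕ, (∀ q, y q ≤ N) → (∑ q ∈ Finset.Icc 1 ⌊(N : ℝ) ^ ε₀⌋₊, |∑ n ∈ (Finset.Icc 1 (y q)).filter (fun n : ℕ => n ≡ w q [MOD q]), ArithmeticFunction.vonMangoldt n * (ArithmeticFunction.liouville (Int.toNat ((n : ℤ) + h)) : ℝ)|) ≤ C * N / Real.log N ^ A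

/-- item stmt-Parity-14995 · crux · rank 9 · open · by planner
why it might fail: Conjunct 5 (pairs → GHL) holds prime k-tuples, k ≥ 3, and Siegel-hard shift-uniformity (MatomakiMerikoski2023 Thm 1.3); conjuncts 3–4 can fail AS STATED at junctions: one-residue BV-λ vs τ(r)² multiplicity of (d,q) ↦ lcm(d,q), moduli ek² ≤ 2N^{ε₀/2}log¹⁰N in level N^{ε₀}, singular-series identity.
sources: GreenTao2010, MatomakiMerikoski2023, HardyLittlewood1923, Vaughan1980, Heathbrown1982, MurtyVatwani2017
[crux] ONE-PIECE DOWNSTREAM of MAD ∧ EH (crux-only repair 2026-08-16: only crux items may be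
hypotheses of `closes`, and the 7-crux cap is full, so the complementary sector rides here instead
of as the separate shared item PairsToGHL). EngineToGHL := (CosetDecorrelation → FanDecorrelation →
DilatedChowla) ∧ (DilatedChowla → TypeIILiouville) ∧ (TypeIILiouville → LambdaLiouvilleLevel) ∧
(LambdaLiouvilleLevel → ElliottHalberstam → PairsHL) ∧ (PairsHL → GeneralizedHardyLittlewood),
PairsHL inlined (Σ_{n≤N} Λ(n)Λ(n+h) = 𝔖({0,h})·N + o(N) for every h ≥ 1). Conjuncts 1–4 are
DEFINITIONALLY the route's four routine reductions, each ALSO listed as a separately closable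
support item (inlined here, not named, only because the gate renders cruxes before supports): 1 =
DecorrelationToDilatedChowla (DivisorSwitch bookkeeping, S; sorry-free candidate proofs attached as
evidence on stmt-Parity-13321), 2 = DilatedChowlaToTypeII (Cauchy–Schwarz over the long variable, S;
candidate proofs on stmt-Parity-13323), 3 = TypeIIToLevel (Vaughan/Heath-Brown inside classes mod q
≤ N^{ε₀} with the PROVED tree theorem BV-for-λ LiouvilleShiftedTables.BVLiouville as Type-I input,
L), 4 = LevelToPairs (Murty–Vatwa -/
@[route_item "route-Parity-LiouvilleMAD"]
def EngineToGHL : Prop :=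
  (CosetDecorrelation → FanDecorrelation → DilatedChowla) ∧ (DilatedChowla → TypeIILiouville) ∧ (TypeIILiouville → LambdaLiouvilleLevel) ∧ (LambdaLiouvilleLevel → ElliottHalberstam → ∀ h : ℕ, 1 ≤ h → (fun N : ℕ => ∑ n ∈ Finset.Icc 1 N, ArithmeticFunction.vonMangoldt n * ArithmeticFunction.vonMangoldt (n + h) - Literature.NumberTheory.Sieve.singularSeries ({0, (h : ℤ)} : Finset ℤ) * N) =o[Filter.atTop] fun N : ℕ => (N : ℝ)) ∧ ((∀ h : ℕ, 1 ≤ h → (fun N : ℕ => ∑ n ∈ Finset.Icc 1 N, ArithmeticFunction.vonMangoldt n * ArithmeticFunction.vonMangoldt (n + h) - Literature.NumberTheory.Sieve.singularSeries ({0, (h : ℤ)} : Finset ℤ) * N) =o[Filter.atTop] fun N : ℕ => (N : ℝ)) → GeneralizedHardyLittlewood)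

/-- item stmt-Parity-14985 · aside · rank 1 · open · by operator
why it might fail: ElliottHalberstam is an open named conjecture; the route is only as good as it
sources: conditional_on
the route's named condition Literature.NumberTheory.Sieve.LevelOfDistribution.ElliottHalberstam, now
a CRUX of the route (bridge-only default, 2026-08-16) -/
@[route_item "route-Parity-LiouvilleMAD"]
def ElliottHalberstamCond : Prop :=
  _root_.Literature.NumberTheory.Sieve.LevelOfDistribution.ElliottHalberstam

/-- item stmt-Parity-13320 · support · rank 9 · closed · proved by Summit.Parity.GeneralizedHardyLittlewood.Theorems.DivisorSwitch_proof @ fc0af8a054e0 (prover) · by planner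
sources: DukeFriedlanderIwaniec1994, HeathBrown1996Crelle481, IwaniecKowalski2004
[support] the δ-method as an exact elementary identity (DFI divisor switching with sharp weights, no
Fourier analysis; = retired stmt-Parity-8053 verbatim): for every f : ℕ → ℕ → ℝ and all M, Q,
|J|·Σ_{m∈(M,2M]} f(m,m) + Σ_{0<|k|≤M} Σ_{j∈J} Σ_{m−m′=kj} f(m,m′) = Σ_{j∈J} Σ_{m≡m′ (mod j)}
f(m,m′), J = [Q,2Q), pairs in (M,2M]². Proof: for each j ≥ 1 split the coset by k = (m−m′)/j ∈
[−M,M]; k = 0 is the diagonal. [difficulty: provable-now] -/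
@[route_item "route-Parity-LiouvilleMAD"]
def DivisorSwitch : Prop :=
  ∀ (f : ℕ → ℕ → ℝ) (M Q : ℕ), ((Finset.Ico Q (2 * Q)).card : ℝ) * (∑ m ∈ Finset.Ioc M (2 * M), f m m) + (∑ k ∈ (Finset.Icc (-(M : ℤ)) M).erase 0, ∑ j ∈ Finset.Ico Q (2 * Q), ∑ p ∈ (Finset.Ioc M (2 * M) ×ˢ Finset.Ioc M (2 * M)).filter (fun p : ℕ × ℕ => (p.1 : ℤ) - p.2 = k * (j : ℤ)), f p.1 p.2) = ∑ j ∈ Finset.Ico Q (2 * Q), ∑ p ∈ (Finset.Ioc M (2 * M) ×ˢ Finset.Ioc M (2 * M)).filter (fun p : ℕ × ℕ => p.1 ≡ p.2 [MOD j]), f p.1 p.2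

-- `DivisorSwitch` holds: proved by `Summit.Parity.GeneralizedHardyLittlewood.Theorems.DivisorSwitch_proof` @ fc0af8a054e0 (its module imports this route file, so no `_holds` link can be stated here).

/-- item stmt-Parity-13321 · support · rank 9 · closed · proved by Summit.Parity.GeneralizedHardyLittlewood.Theorems.decorrelationToDilatedChowla_proof (prover) · by planner
sources: DukeFriedlanderIwaniec1994, Pitt2012
[support] CosetDecorrelation → FanDecorrelation → DilatedChowla. Proof: DivisorSwitch with f(m,m′) =
λ(mn+c)λ(m′n′+c), Q = ⌊√M⌋+1 (so |J| = Q, Q² > M); the fan sums are EMPTY for |k| > M/Q, so |S| ≤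
(1/Q)(Q·C₁M^{3/4+ϑ₁} + (2M/Q)·C₂M^{3/4+ϑ₂}) ≤ (C₁+2C₂)M^{1−κ}, κ = 1/4 − max(ϑ₁,ϑ₂) > 0; M = 0 is
vacuous. [difficulty: provable-now] -/
@[route_item "route-Parity-LiouvilleMAD"]
def DecorrelationToDilatedChowla : Prop :=
  CosetDecorrelation → FanDecorrelation → DilatedChowla

-- `DecorrelationToDilatedChowla` holds: proved by `Summit.Parity.GeneralizedHardyLittlewood.Theorems.decorrelationToDilatedChowla_proof` (its module imports this route file, so no `_holds` link can be stated here).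

/-- item stmt-Parity-13323 · support · rank 9 · closed · proved by Summit.Parity.GeneralizedHardyLittlewood.Theorems.dilatedChowlaToTypeII_proof (prover) · by planner
sources: Harman2007, IwaniecKowalski2004
[support] DilatedChowla → TypeIILiouville by Cauchy–Schwarz over the long variable: |B|² ≤ ‖α‖²
Σ_{n,n′} β_nβ_{n′} Σ_m λ(mn+c)λ(mn′+c) ≤ ‖α‖²‖β‖²(M + N·C M^{1−κ}) (diagonal n = n′ has M terms;
(Σ|β_n|)² ≤ N‖β‖²; n′ ≤ 2N ≤ 2M is inside DilatedChowla's range), so η = κ/2 and √(a+b) ≤ √a + √b (=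
retired stmt-Parity-8056). [difficulty: provable-now] -/
@[route_item "route-Parity-LiouvilleMAD"]
def DilatedChowlaToTypeII : Prop :=
  DilatedChowla → TypeIILiouville

-- `DilatedChowlaToTypeII` holds: proved by `Summit.Parity.GeneralizedHardyLittlewood.Theorems.dilatedChowlaToTypeII_proof` (its module imports this route file, so no `_holds` link can be stated here).

-- earlier LevelToPairs (stmt-Parity-13327, replaced 2026-08-16T03:31:44Z -> stmt-Parity-14550): retired by None — LambdaLiouvilleLevel → EH → ∀ h : ℕ, 1 ≤ h → (fun N : ℕ => ∑ n ∈ Finset.Icc 1 N, ArithmeticFunction.vonMangoldt n * ArithmeticFunction.vonMangoldt (n + h) - Literature.NumberTheory.Sieve.singularSeries ({0, (h : ℤ)} : Finset ℤ) * N) =o[Filter.atTop] fun N : ℕ => (N : ℝ)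
/-- item stmt-Parity-14550 · support · rank 9 · closed · proved by Summit.Parity.GeneralizedHardyLittlewood.Theorems.levelToPairs_proof (prover) · by planner
sources: Vatwani2016, MurtyVatwani2017, Newman1980, HardyLittlewood1923, HalberstamRichert1974
[support] Murty–Vatwani in λ-form with Λ-weights: LambdaLiouvilleLevel → ElliottHalberstam → for
every h ≥ 1, Σ_{n≤N} Λ(n)Λ(n+h) = 𝔖({0,h})·N + o(N) (the PairsHL statement = stmt-Parity-9387/0867,
inlined). Plan (Vatwani2016 §7.4 transposed): expand the SECOND factor Λ(n+h) = Σ_{de=n+h} μ(d) log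
e. Small d ≤ D = N^{1−ε₁} (ε₁ = ε₀(h)/2): ElliottHalberstam (EH) at θ = 1−ε₁/2 with the residue −h
(coprime to d when (d,h) = 1; for (d,h) > 1 only prime powers of p ∣ h occur, ≪ D log³N) and partial
summation for the weight log((n+h)/d) give the main term −N·Σ_{(d,h)=1} μ(d) log d/φ(d) + o(N) =
𝔖({0,h})·N + o(N), using Σ_{d≤D,(d,h)=1} μ(d)/φ(d) ≪ (log D)^{−2} and the identity −Σ_{(d,h)=1}
μ(d)log d/φ(d) = singularSeries {0,h} (F(s) = Σ_{(d,h)=1} μ(d)/(φ(d)d^s) = G(s)/ζ(s+1), F′(0) =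
G(0); both sides vanish for odd h; Vatwani2016 pp.178–181 via Newman1980, or elementarily from the
PNT for μ; tree: tendsto_singularSeriesPartial for the limit form). Large d > D ⇔ e = (n+h)/d <
2N^{ε₁}: μ((n+h)/e) = λ(e)λ(n+h)Σ_{k²∣(n+h)/e} μ(k); truncate k ≤ K = log⁵N (tail ≪ N log³N/K), and
bound Σ_{e≤2N^{ε₁}} Σ_{k≤K} log e·|Σ_{De−h<n≤N, n≡−h (ek²)} Λ(n)λ(n+h)| ≤ 2K log N · Σ_{q ≤ N^{ε₀}}
max_{w,y}|Σ_{n≤y,n≡ -/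
@[route_item "route-Parity-LiouvilleMAD"]
def LevelToPairs : Prop :=
  LambdaLiouvilleLevel → ElliottHalberstam → ∀ h : ℕ, 1 ≤ h → (fun N : ℕ => ∑ n ∈ Finset.Icc 1 N, ArithmeticFunction.vonMangoldt n * ArithmeticFunction.vonMangoldt (n + h) - Literature.NumberTheory.Sieve.singularSeries ({0, (h : ℤ)} : Finset ℤ) * N) =o[Filter.atTop] fun N : ℕ => (N : ℝ)

-- `LevelToPairs` holds: proved by `Summit.Parity.GeneralizedHardyLittlewood.Theorems.levelToPairs_proof` (its module imports this route file, so no `_holds` link can be stated here).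

-- earlier TypeIIToLevel (stmt-Parity-13326, replaced 2026-08-16T07:17:29Z -> stmt-Parity-14996): retired by None — TypeIILiouville → BombieriVinogradovLiouville → LambdaLiouvilleLevel
/-- item stmt-Parity-14996 · support · rank 9 · closed · proved by Summit.Parity.GeneralizedHardyLittlewood.Theorems.TypeIIToLevel.TypeIIToLevel_proof (prover) · by planner
sources: Vaughan1980, Heathbrown1982, Harman2007, IwaniecKowalski2004, BombieriFriedlanderIwaniecActa1986
[support] TypeIILiouville → LambdaLiouvilleLevel — restated 2026-08-16 from stmt-Parity-13326
(TypeIILiouville → BombieriVinogradovLiouville → LambdaLiouvilleLevel): the middle hypothesis,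
Bombieri–Vinogradov for λ at level x^{1/2−ε} with one residue and one height per modulus, is a
PROVED tree theorem —
`Summit.Parity.GeneralizedHardyLittlewood.Theses.LiouvilleShiftedTables.BVLiouville`, proof
`BVLiouville_proof` in Theorems/LiouvilleShiftedTablesBVLiouville.lean (=
Cruxes.TypeI2Dilated.PeelToDrappeau.stub_bvLiouville @ 7013b04e1aff; verbatim the signature of the
former item stmt-Parity-13324) — import that module in YOUR Theorems file and invoke it inside the
proof (never in this route file: its import closure carries 29 unproved wave-0 named facts into the
module cone). = conjunct 3 of the crux EngineToGHL (definitionally). Plan (unchanged): Vaughan's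
identity with U = V = N^{1/10} (or Heath-Brown's, tree: heathBrown_identity) on Λ(n) inside the
class n ≡ w (q), q ≤ N^{ε₀}. TYPE I pieces Σ_{d ≤ N^{1/5}} a_d Σ_{k: dk ≡ w (q)} (1 or log
k)·λ(dk+h): for each d the congruence fixes ONE class of k mod q/(d,q), so the inner sum is λ on an
AP of modulus lcm(d,q) ≤ N^{1/5+ε₀}; aggregate -/
@[route_item "route-Parity-LiouvilleMAD"]
def TypeIIToLevel : Prop :=
  TypeIILiouville → LambdaLiouvilleLevel

-- `TypeIIToLevel` holds: proved by `Summit.Parity.GeneralizedHardyLittlewood.Theorems.TypeIIToLevel.TypeIIToLevel_proof` (its module imports this route file, so no `_holds` link can be stated here).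

-- earlier Assembly (stmt-Parity-13329, replaced 2026-08-16T03:31:44Z -> stmt-Parity-14551): retired by None — CosetDecorrelation → FanDecorrelation → BombieriVinogradovLiouville → EH → PairsToGHL → GeneralizedHardyLittlewood
-- earlier Assembly (stmt-Parity-14551, replaced 2026-08-16T07:17:29Z -> stmt-Parity-14997): retired by None — CosetDecorrelation → FanDecorrelation → BombieriVinogradovLiouville → ElliottHalberstam → PairsToGHL → GeneralizedHardyLittlewood
/-- item stmt-Parity-14997 · assembly · rank 1 · closed · proved by Summit.Parity.GeneralizedHardyLittlewood.Theorems.liouvilleMADAssembly_proof (prover) · by planner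
sources: Pitt2012, MurtyVatwani2017, GreenTao2010
[assembly] CosetDecorrelation → FanDecorrelation → ElliottHalberstam → EngineToGHL →
GeneralizedHardyLittlewood — the type of the crux-only deciding theorem `closes` (repair 2026-08-16:
`closes h₁ h₂ hEH hX := hX.2.2.2.2 (hX.2.2.2.1 (hX.2.2.1 (hX.2.1 (hX.1 h₁ h₂))) hEH)`); restated
from the rev-9 chain CosetDecorrelation → FanDecorrelation → BombieriVinogradovLiouville →
ElliottHalberstam → PairsToGHL → GeneralizedHardyLittlewood (BV-λ is proved and no longer an item;
PairsToGHL is conjunct 5 of EngineToGHL). Provable now by `theorem assembly : Assembly := closes`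
(planner Sketch.lean rc 0). [difficulty: provable-now] -/
@[route_item "route-Parity-LiouvilleMAD"]
def Assembly : Prop :=
  CosetDecorrelation → FanDecorrelation → ElliottHalberstam → EngineToGHL → GeneralizedHardyLittlewood

-- `Assembly` holds: proved by `Summit.Parity.GeneralizedHardyLittlewood.Theorems.liouvilleMADAssembly_proof` (its module imports this route file, so no `_holds` link can be stated here).

-- records of items no longer active in this route (dropped / restated):
-- earlier BombieriVinogradovLiouville (stmt-Parity-13324, dropped 2026-08-16T07:17:29Z): proved by Summit.Parity.GeneralizedHardyLittlewood.Cruxes.TypeI2Dilated.PeelToDrappeau.stub_bvLiouville @ 728982fbd7eb — ∀ ε : ℝ, 0 < ε → ∀ A : ℝ, 0 < A → ∃ C x₀ : ℝ, ∀ x : ℝ, x₀ ≤ x → ∀ c : ℕ → ℤ, ∀ y : ℕ → ℝ, (∀ d, 1 ≤ d → 0 ≤ c d ∧ c d < d) → (∀ d, 0 ≤ y d ∧ y d ≤ x) → (∑ d ∈ Finset.Icc 1 ⌊x ^ (1 / 2 - ε)⌋₊, 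

/-! D-0027 §2.1 — DECIDING THEOREM (planner-authored via `route open/edit --closes-file`; by planner-rbadge-Parity-LiouvilleMAD-adc0542d-g3-0 2026-08-16T07:17:29Z):
its hypotheses are this route's items and its conclusion the sub-problem Statement (glue_lint), and it elaborates with this file. -/

/-- D-0027 §2.1 deciding theorem of route LiouvilleMAD — CRUX-ONLY form (human ruling 2026-08-16: only crux
items may be hypotheses of `closes`). CONDITIONAL BRIDGE on the crux `ElliottHalberstam` (:= the conditional_on
constant `Literature.NumberTheory.Sieve.LevelOfDistribution.ElliottHalberstam` by name, stmt-Parity-14092).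
Hypotheses: the MAD cruxes `CosetDecorrelation` (rank 2) and `FanDecorrelation` (rank 3), the bridge premise, and the
rank-9 crux `EngineToGHL` = the route's whole downstream of MAD ∧ EH as ONE item: the conjunction of the four routine
reductions — conjunct k is DEFINITIONALLY the support item `DecorrelationToDilatedChowla` (S; sorry-free candidate proofs
attached as evidence on stmt-Parity-13321), `DilatedChowlaToTypeII` (S; candidate proofs on stmt-Parity-13323),
`TypeIIToLevel` (L; Vaughan/Heath-Brown with the PROVED tree theorem BV-for-λ `LiouvilleShiftedTables.BVLiouville` used
inside the proof), `LevelToPairs` (L; Murty–Vatwani in λ-form), which stay listed as separately closable SUPPORT items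
(inlined rather than named only because the gate renders cruxes before supports) — with the complementary sector
"Hardy–Littlewood pairs at every fixed shift → GeneralizedHardyLittlewood" (verbatim the shared statement PairsToGHL =
stmt-Parity-9389 of RoughSemiprimeRigidity / HullDial / LiouvilleShiftedTables, folded in here because the 7-crux cap
leaves no separate slot). The proof threads the nodes — `hX.1 h₁ h₂ : DilatedChowla`, `hX.2.1 _ : TypeIILiouville`,
`hX.2.2.1 _ : LambdaLiouvilleLevel`, `hX.2.2.2.1 _ hEH : PairsHL`, `hX.2.2.2.2 _ : GHL` — so every declared crux lies in
the cone of `closes`. END FORM once the four supports are proved (tenure restates EngineToGHL ↦ PairsToGHL):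
`closes h₁ h₂ hEH hR := hR (LevelToPairs_holds (TypeIIToLevel_holds (DilatedChowlaToTypeII_holds
(DecorrelationToDilatedChowla_holds h₁ h₂))) hEH)`. Pure logic. -/
@[closes "route-Parity-LiouvilleMAD"] theorem closes (h₁ : CosetDecorrelation) (h₂ : FanDecorrelation) (hEH : ElliottHalberstam) (hX : EngineToGHL) :
    GeneralizedHardyLittlewood :=
  hX.2.2.2.2 (hX.2.2.2.1 (hX.2.2.1 (hX.2.1 (hX.1 h₁ h₂))) hEH)

end Summit.Parity.GeneralizedHardyLittlewood.Theses.LiouvilleMAD
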